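import Summits.QuantumFields.YangMills.Theorems.BalabanUVNodesN21GappedPairRoadCutZeroKnit
import Summits.QuantumFields.YangMills.Theorems.BalabanUVNodesN21GappedTopPairReading13CoPHSignFree
import Summits.QuantumFields.YangMills.Theorems.BalabanUVNodesN21GappedPairRoadK3V6KnitOfCloseness

/-!
# N21 (NE7c) · THE PAIR ROAD, SIGN-FREE EDITION — the ∃-faces form and V7's zero-cut END-shape at PLAIN dials re-based on dag-n21-w7's SIGN-FREE pair faces
# (via dag-n21-w2's sign-free knit): NO rows about the signs of `ε`, `δ`

R134 seat `pub-ymgap-dag-n21-d` (g12, lane owner N21), strategy s2; key K3⁸ `SpineGivenEndpointR13SepCoPHV` = stmt-QuantumFields-27366, `--kind proof --supports 27366 --as helper`;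
COUNT-NEUTRAL.  Theorems only (0 `def`).  Imports V7 `…N21GappedPairRoadCutZeroKnit` (p644453; through it V3 p642482, V1 p629674, dag-n20-w2's zero-cut files) and dag-n21-w7's
`…N21GappedTopPairReading13CoPHSignFree` (`shellWeightBound_carriersGap2₁₃_signFree` ∕ `shellWeightBound_crGap2₁₃VAt_signFree`: rows `hsel`, (H-ζ), `0 ≤ ρ, ρ′ ≤ 1`,
`Σ(1∕(n₁ K+1)+1∕(n₂ K+1)) < ∞` and NOTHING about signs — strictly fewer binders than V6's «sign OR width zero» edition), and dag-n21-w2 g3's `…N21GappedPairRoadK3V6KnitOfCloseness`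
(landed 2026-08-28 15:39Z while this file's INTENT window ran; it already carries the four pinned ∕ pin-free sign-free theorems `keyedShellWeight_of_gap2Pin_signFree`,
`keyedCoreEdgeHolderD4V_of_gap2Pin_of_witness_signFree`, `spineGivenEndpointR13SepCoPHV_of_gap2Pin_signFree`, `spineGivenEndpointR13SepCoPHV_of_gap2Road_signFree` — consumed
BY NAME here, the first filing's copies deleted after the gate's `dedup.landed` bounce p645934) — all BY NAME; nothing re-typed.

WHAT IS PROVED (kernel; [bookkeeping]; NO estimate): the three pair-road theorems NOT in dag-n21-w2's file — `exists_gap2Pinned_faces_signFree` (∃ a reading pinned to `crGap2₁₃V` with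
ALL FOUR K5 faces, no sign rows) · ★★★ `spineGivenEndpointR13SepCoPHV_of_gap2Road_cutZero_signFree` (THE FEWEST BINDERS on the pair road: (H-ζ) on the live line, dials in [0,1] with
`Σ(1∕(n₁ K+1)+1∕(n₂ K+1)) < ∞`, K4, N19′ = the one-constant NE7 sandwich on EVERY keyed class between the two runs' DOUBLY-GAPPED cores, node U5's Target off-live; N21 ∕ N27x by theorem,
N20's WITNESS BINDER discharged at the zero cut — vacuously, the persistence class being empty; ref-I READ-474 NIT-1 wording honoured) · `exists_gap2Pinned_faces_cutZero_signFree`.  V3 ∕ V7 (V6 rows) remain for dial-dependent consumers.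

HONEST FRAMING (binding).  Compositions BY NAME; NO estimate of Bałaban's; NE7c at print's FIXED thresholds NOT PRINTED ∕ NOT proved; K4 ∕ N20 ∕ N19′ ∕ Target are HYPOTHESES
(N19′'s sandwich NOT PRINTED for `d = 4`; inhabited for no family, K0⁷ OPEN); (H-ζ) displayed (not derivable from the item's antecedents); NOT `stub_expansion13HV` (its `PinnedAtLive`
names `crOfRecord₁₃V`); N21 NOT discharged at the v6 pin; K3⁸ NOT claimed; counts UNMOVED (typed 28∕28 · discharged 5∕27); never a count claim.  No `sorry`, no `def`, no `instance`,
no `notation`; standard axioms.  One finite four-torus programme at fixed `ε` — NOT ℝ⁴, NOT OS, NOT a mass gap, NOT the Clay problem.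
-/

set_option autoImplicit false

noncomputable section

open scoped BigOperators

namespace Summit.QuantumFields.YangMills.Theorems.N21GappedRoadK3V6Knit

open Literature.MathematicalPhysics.QuantumFieldTheory.Balaban1983to89
open Literature.MathematicalPhysics.QuantumFieldTheory.Balaban1983to89.T4Continuum
open Literature.MathematicalPhysics.QuantumFieldTheory.Balaban1983to89.Node00
open T4WeightBudget (RelWeightBound)
open T4IndicatorShell (ShellWeightBound)
open T4ContinuumYM4Torus (ForSmallCouplings)
open Summit.QuantumFields.BalabanUV.T4Continuum.Spine
open Summit.QuantumFields.YangMills.BalabanUVNodes.SpineCanonicalWeights (core_nonneg_of_shellWeightBound)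
open YMDAG.UVSplit (SpineReading₁₃CoPH classSet₁₃ badClass₁₃ histA₁₃ histB₁₃)
open Summit.QuantumFields.YangMills.Theorems.K3V5Defs (SpineReading RateReadingFn CutReading KeyedRelWeight KeyedShellWeight LiveSel PHolderD4)
open Summit.QuantumFields.YangMills.Theorems.K3V6Defs (KeyedRatesHolderD4V KeyedCoreEdgeHolderD4V KeyedExtractionV spineGivenEndpointR13SepCoPHV_of_facesV)
open Summit.QuantumFields.YangMills.BalabanUVNodes.N20OffLiveOneTermReading (crOneTerm₁₃)
open Summit.QuantumFields.YangMills.Theorems.N21ShellSplitOfRecord13CoPH (WidthLetter₁₃CoPH DepthLetter₁₃CoPH)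
open Summit.QuantumFields.YangMills.Theorems.N21GappedTopPair13CoPH (crGap2₁₃V crGap2₁₃VAt gapWeight2A₁₃ gapWeight2B₁₃ gapShell2A₁₃ gapShell2B₁₃ gapCore2A₁₃ gapCore2B₁₃
  core_crGap2₁₃VAt gapWeight2A₁₃_sub_gapShell2A₁₃ gapWeight2B₁₃_sub_gapShell2B₁₃ shellWeightBound_carriersGap2₁₃_signFree shellWeightBound_crGap2₁₃VAt_signFree)
open Summit.QuantumFields.YangMills.BalabanUVNodes.N20GappedRoadCutZeroKnit (core_badClass₁₃_cutZero_of_allClasses)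
open Summit.QuantumFields.YangMills.Theorems.N21GappedPairRoadK3V6KnitOfCloseness (keyedShellWeight_of_gap2Pin_signFree keyedCoreEdgeHolderD4V_of_gap2Pin_of_witness_signFree
  spineGivenEndpointR13SepCoPHV_of_gap2Pin_signFree spineGivenEndpointR13SepCoPHV_of_gap2Road_signFree)

/-! ## §7 The pair road, sign-free: the ∃-faces form and the zero cut (the pinned ∕ pin-free theorems are dag-n21-w2 g3's `…PairRoadK3V6KnitOfCloseness`, landed 15:39Z — consumed BY NAME) -/

section Gap2RoadSF

variable (ρ ρ' : WidthLetter₁₃CoPH 2) (n₁ n₂ : DepthLetter₁₃CoPH 2)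

/-- ★★ **WHAT STUB 2 WOULD READ UNDER A PAIR PIN**: a spine reading pinned to `crGap2₁₃V 2 (jc …) ρ ρ′ n₁ n₂` on the live line ∕ `crOneTerm₁₃ 0` off it carrying ALL FOUR K5 faces,
N21's and N27x's by THEOREM. [bookkeeping] -/
theorem exists_gap2Pinned_faces_signFree (β : ℝ) (rr : RateReadingFn) (jc : CutReading) (ρ ρ' : WidthLetter₁₃CoPH 2) (n₁ n₂ : DepthLetter₁₃CoPH 2)
    (hζm : ∀ (F : T4Family) (θ : Stage13HParams F 2), θ.Provisos₁₃CoPH F 2 → ((θ.ZhUnity F 2 ∧ θ.SlotsNondegenerate₁₃ F 2) ∧ LiveSel F θ) → θ.Admissible F 2 →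
      ZetaMeasurable F 2 θ.ζ)
    (hρ : ∀ (F : T4Family) (θ : Stage13HParams F 2) (hP : θ.Provisos₁₃CoPH F 2) (g₀ : ℕ → ℝ) (os : List (ULoop F)) (K : ℕ),
      (0 ≤ ρ F θ hP g₀ os K ∧ ρ F θ hP g₀ os K ≤ 1) ∧ (0 ≤ ρ' F θ hP g₀ os K ∧ ρ' F θ hP g₀ os K ≤ 1))
    (hn : ∀ (F : T4Family) (θ : Stage13HParams F 2) (hP : θ.Provisos₁₃CoPH F 2) (g₀ : ℕ → ℝ) (os : List (ULoop F)),
      Summable (fun K => 1 / ((n₁ F θ hP g₀ os K : ℝ) + 1) + 1 / ((n₂ F θ hP g₀ os K : ℝ) + 1)))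
    (h20 : ∀ (F : T4Family) (θ : Stage13HParams F 2) (hP : θ.Provisos₁₃CoPH F 2), ((θ.ZhUnity F 2 ∧ θ.SlotsNondegenerate₁₃ F 2) ∧ LiveSel F θ) → θ.Admissible F 2 →
      ∀ (g₀ : ℕ → ℝ) (os : List (ULoop F)),
        ∃ W : ℕ → ℝ, RelWeightBound 1 (classSet₁₃ θ 0 g₀)
          (gapWeight2A₁₃ θ hP 0 g₀ os (ρ F θ hP g₀ os) (ρ' F θ hP g₀ os) (n₁ F θ hP g₀ os) (n₂ F θ hP g₀ os))
          (gapWeight2B₁₃ θ hP 0 g₀ os (ρ F θ hP g₀ os) (ρ' F θ hP g₀ os) (n₁ F θ hP g₀ os) (n₂ F θ hP g₀ os)) (badClass₁₃ θ 0 g₀ (jc F θ hP g₀ os)) W)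
    (h19 : ∀ (F : T4Family) (θ : Stage13HParams F 2) (h : θ.Provisos₁₃SepCoPH F 2) (v : Revision₁₃ F 2 θ h),
      ((θ.ZhUnity F 2 ∧ θ.SlotsNondegenerate₁₃ F 2) ∧ LiveSel F θ) → θ.Admissible F 2 →
      B16.EndStatementBPrinted (datumOfRecord₁₃SepCoPHV F 2 θ h v).C → DagBinding.EndpointExistence (datumOfRecord₁₃SepCoPHV F 2 θ h v).C.toB12 →
        ForSmallCouplings (datumOfRecord₁₃SepCoPHV F 2 θ h v) fun g₀ => ∀ os : List (ULoop F),
          PHolderD4 β (datumOfRecord₁₃SepCoPHV F 2 θ h v) (rr F θ h.toCore g₀ os) →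
            letI : DecidableEq (Σ K, SiteSeqKey F (0 + K)) := Classical.decEq _
            ∃ δ : ℕ → ℝ, NE7.Core 1 (F.side ^ 4) (classSet₁₃ θ 0 g₀) (badClass₁₃ θ 0 g₀ (jc F θ h.toCore g₀ os))
              (gapCore2A₁₃ θ h.toCore 0 g₀ os (ρ F θ h.toCore g₀ os) (ρ' F θ h.toCore g₀ os) (n₁ F θ h.toCore g₀ os) (n₂ F θ h.toCore g₀ os))
              (gapCore2B₁₃ θ h.toCore 0 g₀ os (ρ F θ h.toCore g₀ os) (ρ' F θ h.toCore g₀ os) (n₁ F θ h.toCore g₀ os) (n₂ F θ h.toCore g₀ os)) δ ∧ Summable δ)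
    (htarget : ∀ (F : T4Family) (θ : Stage13HParams F 2) (hP : θ.Provisos₁₃CoPH F 2), ((θ.ZhUnity F 2 ∧ θ.SlotsNondegenerate₁₃ F 2) ∧ ¬ LiveSel F θ) → θ.Admissible F 2 →
      ∀ (g₀ : ℕ → ℝ) (os : List (ULoop F)), PHolderD4 β (datumOfRecord₁₃CoPH F 2 θ hP) (rr F θ hP g₀ os) →
        ∃ δ : ℕ → ℝ, NE7.Target ((F.side : ℝ) ^ 4) 1 δ (fun K => T4GenFunBounds.schemeZ ((datumOfRecord₁₃CoPH F 2 θ hP).scheme g₀) os (0 + K))) :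
    ∃ cr : SpineReading,
      (∀ (F : T4Family) (θ : Stage13HParams F 2) (hP : θ.Provisos₁₃CoPH F 2) (g₀ : ℕ → ℝ) (os : List (ULoop F)),
        LiveSel F θ → cr F θ hP g₀ os = crGap2₁₃V 2 (jc F θ hP g₀ os) ρ ρ' n₁ n₂ F θ hP g₀ os) ∧
      (∀ (F : T4Family) (θ : Stage13HParams F 2) (hP : θ.Provisos₁₃CoPH F 2) (g₀ : ℕ → ℝ) (os : List (ULoop F)),
        ¬ LiveSel F θ → cr F θ hP g₀ os = crOneTerm₁₃ 0 F θ hP g₀ os) ∧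
      KeyedRelWeight cr ∧ KeyedShellWeight cr ∧ KeyedExtractionV cr ∧ KeyedCoreEdgeHolderD4V β cr rr := by
  obtain ⟨cr, hon, hoff⟩ := exists_reading_livePin (fun F θ hP g₀ os => crGap2₁₃V 2 (jc F θ hP g₀ os) ρ ρ' n₁ n₂ F θ hP g₀ os)
  exact ⟨cr, hon, hoff, keyedRelWeight_of_gap2Pin_of_witness jc ρ ρ' n₁ n₂ hon hoff h20, keyedShellWeight_of_gap2Pin_signFree jc ρ ρ' n₁ n₂ hon hoff hζm hρ hn,
    (keyedExtraction_of_gap2Pin jc ρ ρ' n₁ n₂ hon hoff hζm).2, keyedCoreEdgeHolderD4V_of_gap2Pin_of_witness_signFree jc ρ ρ' n₁ n₂ hon hoff hζm β rr hρ hn h19 htarget⟩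

/-- ★★★ **K3⁸ ON THE PAIR ROAD AT THE ZERO CUT, PIN-FREE — NO N20 LINE.**  Binder by binder: (H-ζ) on the guarded admissible tuples of the live-selector line; the dial rows
`0 ≤ ρ, ρ′ ≤ 1`, `Σ_K (1∕(n₁ K+1) + 1∕(n₂ K+1)) < ∞`; NO sign rows; K4 `KeyedRatesHolderD4V β rr`;
N19′ = for every slot `v`, under (B) → END → `ForSmallCouplings` and `PHolderD4 β`, «∃ summable `δ`, for every `K` ONE constant `c` with
`e^{c − vol·δ_K}·gapCore2A ≤ gapCore2B ≤ e^{c + vol·δ_K}·gapCore2A` on EVERY keyed class, `|t| ≤ 1`» (NE7 proper between the two runs' DOUBLY-GAPPED cores — no top (3.2) statistic in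
`(θ_{i⋆+2}, θ_{i⋆})` and no top (3.3) statistic in `(δ′_{j⋆+2}, δ′_{j⋆})` in either run; NOT PRINTED for `d = 4`); node U5's Target off the live line.  N20's WITNESS BINDER is discharged at the zero cut (V7's `exists_relWeightBound_carriersGap2₁₃_cutZero` — vacuous: the persistence class `badClass₁₃ θ 0 g₀ (fun _ ↦ 0)` is
empty; this is NOT node N20's estimate); N21 ∕ N27x are V3's ∕ this file's theorems.  CONDITIONAL; NOT `stub_expansion13HV`; K3⁸ NOT claimed. [bookkeeping] -/
theorem spineGivenEndpointR13SepCoPHV_of_gap2Road_cutZero_signFree (β : ℝ) (rr : RateReadingFn)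
    (hζm : ∀ (F : T4Family) (θ : Stage13HParams F 2), θ.Provisos₁₃CoPH F 2 → ((θ.ZhUnity F 2 ∧ θ.SlotsNondegenerate₁₃ F 2) ∧ LiveSel F θ) → θ.Admissible F 2 →
      ZetaMeasurable F 2 θ.ζ)
    (hρ : ∀ (F : T4Family) (θ : Stage13HParams F 2) (hP : θ.Provisos₁₃CoPH F 2) (g₀ : ℕ → ℝ) (os : List (ULoop F)) (K : ℕ),
      (0 ≤ ρ F θ hP g₀ os K ∧ ρ F θ hP g₀ os K ≤ 1) ∧ (0 ≤ ρ' F θ hP g₀ os K ∧ ρ' F θ hP g₀ os K ≤ 1))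
    (hn : ∀ (F : T4Family) (θ : Stage13HParams F 2) (hP : θ.Provisos₁₃CoPH F 2) (g₀ : ℕ → ℝ) (os : List (ULoop F)),
      Summable (fun K => 1 / ((n₁ F θ hP g₀ os K : ℝ) + 1) + 1 / ((n₂ F θ hP g₀ os K : ℝ) + 1)))
    (hr : KeyedRatesHolderD4V β rr)
    (h19 : ∀ (F : T4Family) (θ : Stage13HParams F 2) (h : θ.Provisos₁₃SepCoPH F 2) (v : Revision₁₃ F 2 θ h),
      ((θ.ZhUnity F 2 ∧ θ.SlotsNondegenerate₁₃ F 2) ∧ LiveSel F θ) → θ.Admissible F 2 →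
      B16.EndStatementBPrinted (datumOfRecord₁₃SepCoPHV F 2 θ h v).C → DagBinding.EndpointExistence (datumOfRecord₁₃SepCoPHV F 2 θ h v).C.toB12 →
        ForSmallCouplings (datumOfRecord₁₃SepCoPHV F 2 θ h v) fun g₀ => ∀ os : List (ULoop F),
          PHolderD4 β (datumOfRecord₁₃SepCoPHV F 2 θ h v) (rr F θ h.toCore g₀ os) →
            ∃ δ : ℕ → ℝ, (∀ K : ℕ, ∃ c : ℝ, ∀ t : ℝ, |t| ≤ 1 → ∀ x ∈ classSet₁₃ θ 0 g₀ K,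
              Real.exp (c - F.side ^ 4 * δ K) *
                  gapCore2A₁₃ θ h.toCore 0 g₀ os (ρ F θ h.toCore g₀ os) (ρ' F θ h.toCore g₀ os) (n₁ F θ h.toCore g₀ os) (n₂ F θ h.toCore g₀ os) K t x ≤
                gapCore2B₁₃ θ h.toCore 0 g₀ os (ρ F θ h.toCore g₀ os) (ρ' F θ h.toCore g₀ os) (n₁ F θ h.toCore g₀ os) (n₂ F θ h.toCore g₀ os) K t x ∧
              gapCore2B₁₃ θ h.toCore 0 g₀ os (ρ F θ h.toCore g₀ os) (ρ' F θ h.toCore g₀ os) (n₁ F θ h.toCore g₀ os) (n₂ F θ h.toCore g₀ os) K t x ≤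
                Real.exp (c + F.side ^ 4 * δ K) *
                  gapCore2A₁₃ θ h.toCore 0 g₀ os (ρ F θ h.toCore g₀ os) (ρ' F θ h.toCore g₀ os) (n₁ F θ h.toCore g₀ os) (n₂ F θ h.toCore g₀ os) K t x) ∧ Summable δ)
    (htarget : ∀ (F : T4Family) (θ : Stage13HParams F 2) (hP : θ.Provisos₁₃CoPH F 2), ((θ.ZhUnity F 2 ∧ θ.SlotsNondegenerate₁₃ F 2) ∧ ¬ LiveSel F θ) → θ.Admissible F 2 →
      ∀ (g₀ : ℕ → ℝ) (os : List (ULoop F)), PHolderD4 β (datumOfRecord₁₃CoPH F 2 θ hP) (rr F θ hP g₀ os) →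
        ∃ δ : ℕ → ℝ, NE7.Target ((F.side : ℝ) ^ 4) 1 δ (fun K => T4GenFunBounds.schemeZ ((datumOfRecord₁₃CoPH F 2 θ hP).scheme g₀) os (0 + K))) :
    Summit.QuantumFields.YangMills.Theses.BalabanUVNodes.SpineGivenEndpointR13SepCoPHV := by
  refine spineGivenEndpointR13SepCoPHV_of_gap2Road_signFree β rr (fun _ _ _ _ _ _ => 0) ρ ρ' n₁ n₂ hζm hρ hn hr
    (exists_relWeightBound_carriersGap2₁₃_cutZero ρ ρ' n₁ n₂) (fun F θ h v hG hθ hB hE => ?_) htarget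
  refine ForSmallCouplings.mono (fun g₀ h' os hPr => ?_) (h19 F θ h v hG hθ hB hE)
  obtain ⟨δ, hδ', hsum⟩ := h' os hPr
  letI : DecidableEq (Σ K, SiteSeqKey F (0 + K)) := Classical.decEq _
  exact ⟨δ, core_badClass₁₃_cutZero_of_allClasses θ g₀ hδ', hsum⟩

/-- ★★ **UNDER A PAIR PIN AT THE ZERO CUT THERE IS A SPINE READING CARRYING ALL FOUR K5 FACES OF STUB 2's BODY — THREE WITHOUT A WITNESS ROW** (N20: the zero-cut binder, vacuous — empty persistence class; N21 ∕ N27x: theorems),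
the fourth (N19′) from the all-classes NE7 binder + node U5's Target off the live line; rows (H-ζ), the dials — no sign rows.  The registered pin is the plan's; this is the kernel form
of the pair alternative at `jc ≡ 0`, nothing more. [bookkeeping] -/
theorem exists_gap2Pinned_faces_cutZero_signFree (β : ℝ) (rr : RateReadingFn)
    (hζm : ∀ (F : T4Family) (θ : Stage13HParams F 2), θ.Provisos₁₃CoPH F 2 → ((θ.ZhUnity F 2 ∧ θ.SlotsNondegenerate₁₃ F 2) ∧ LiveSel F θ) → θ.Admissible F 2 →
      ZetaMeasurable F 2 θ.ζ)
    (hρ : ∀ (F : T4Family) (θ : Stage13HParams F 2) (hP : θ.Provisos₁₃CoPH F 2) (g₀ : ℕ → ℝ) (os : List (ULoop F)) (K : ℕ),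
      (0 ≤ ρ F θ hP g₀ os K ∧ ρ F θ hP g₀ os K ≤ 1) ∧ (0 ≤ ρ' F θ hP g₀ os K ∧ ρ' F θ hP g₀ os K ≤ 1))
    (hn : ∀ (F : T4Family) (θ : Stage13HParams F 2) (hP : θ.Provisos₁₃CoPH F 2) (g₀ : ℕ → ℝ) (os : List (ULoop F)),
      Summable (fun K => 1 / ((n₁ F θ hP g₀ os K : ℝ) + 1) + 1 / ((n₂ F θ hP g₀ os K : ℝ) + 1)))
    (h19 : ∀ (F : T4Family) (θ : Stage13HParams F 2) (h : θ.Provisos₁₃SepCoPH F 2) (v : Revision₁₃ F 2 θ h),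
      ((θ.ZhUnity F 2 ∧ θ.SlotsNondegenerate₁₃ F 2) ∧ LiveSel F θ) → θ.Admissible F 2 →
      B16.EndStatementBPrinted (datumOfRecord₁₃SepCoPHV F 2 θ h v).C → DagBinding.EndpointExistence (datumOfRecord₁₃SepCoPHV F 2 θ h v).C.toB12 →
        ForSmallCouplings (datumOfRecord₁₃SepCoPHV F 2 θ h v) fun g₀ => ∀ os : List (ULoop F),
          PHolderD4 β (datumOfRecord₁₃SepCoPHV F 2 θ h v) (rr F θ h.toCore g₀ os) →
            ∃ δ : ℕ → ℝ, (∀ K : ℕ, ∃ c : ℝ, ∀ t : ℝ, |t| ≤ 1 → ∀ x ∈ classSet₁₃ θ 0 g₀ K,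
              Real.exp (c - F.side ^ 4 * δ K) *
                  gapCore2A₁₃ θ h.toCore 0 g₀ os (ρ F θ h.toCore g₀ os) (ρ' F θ h.toCore g₀ os) (n₁ F θ h.toCore g₀ os) (n₂ F θ h.toCore g₀ os) K t x ≤
                gapCore2B₁₃ θ h.toCore 0 g₀ os (ρ F θ h.toCore g₀ os) (ρ' F θ h.toCore g₀ os) (n₁ F θ h.toCore g₀ os) (n₂ F θ h.toCore g₀ os) K t x ∧
              gapCore2B₁₃ θ h.toCore 0 g₀ os (ρ F θ h.toCore g₀ os) (ρ' F θ h.toCore g₀ os) (n₁ F θ h.toCore g₀ os) (n₂ F θ h.toCore g₀ os) K t x ≤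
                Real.exp (c + F.side ^ 4 * δ K) *
                  gapCore2A₁₃ θ h.toCore 0 g₀ os (ρ F θ h.toCore g₀ os) (ρ' F θ h.toCore g₀ os) (n₁ F θ h.toCore g₀ os) (n₂ F θ h.toCore g₀ os) K t x) ∧ Summable δ)
    (htarget : ∀ (F : T4Family) (θ : Stage13HParams F 2) (hP : θ.Provisos₁₃CoPH F 2), ((θ.ZhUnity F 2 ∧ θ.SlotsNondegenerate₁₃ F 2) ∧ ¬ LiveSel F θ) → θ.Admissible F 2 →
      ∀ (g₀ : ℕ → ℝ) (os : List (ULoop F)), PHolderD4 β (datumOfRecord₁₃CoPH F 2 θ hP) (rr F θ hP g₀ os) →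
        ∃ δ : ℕ → ℝ, NE7.Target ((F.side : ℝ) ^ 4) 1 δ (fun K => T4GenFunBounds.schemeZ ((datumOfRecord₁₃CoPH F 2 θ hP).scheme g₀) os (0 + K))) :
    ∃ cr : SpineReading,
      (∀ (F : T4Family) (θ : Stage13HParams F 2) (hP : θ.Provisos₁₃CoPH F 2) (g₀ : ℕ → ℝ) (os : List (ULoop F)),
        LiveSel F θ → cr F θ hP g₀ os = crGap2₁₃V 2 (fun _ => 0) ρ ρ' n₁ n₂ F θ hP g₀ os) ∧
      (∀ (F : T4Family) (θ : Stage13HParams F 2) (hP : θ.Provisos₁₃CoPH F 2) (g₀ : ℕ → ℝ) (os : List (ULoop F)),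
        ¬ LiveSel F θ → cr F θ hP g₀ os = crOneTerm₁₃ 0 F θ hP g₀ os) ∧
      KeyedRelWeight cr ∧ KeyedShellWeight cr ∧ KeyedExtractionV cr ∧ KeyedCoreEdgeHolderD4V β cr rr := by
  obtain ⟨cr, hon, hoff⟩ :=
    exists_reading_livePin (fun F θ hP g₀ os => crGap2₁₃V 2 ((fun _ _ _ _ _ _ => 0 : CutReading) F θ hP g₀ os) ρ ρ' n₁ n₂ F θ hP g₀ os)
  refine ⟨cr, hon, hoff, keyedRelWeight_of_gap2Pin_cutZero ρ ρ' n₁ n₂ hon hoff, keyedShellWeight_of_gap2Pin_signFree _ ρ ρ' n₁ n₂ hon hoff hζm hρ hn,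
    (keyedExtraction_of_gap2Pin _ ρ ρ' n₁ n₂ hon hoff hζm).2,
    keyedCoreEdgeHolderD4V_of_gap2Pin_of_witness_signFree _ ρ ρ' n₁ n₂ hon hoff hζm β rr hρ hn (fun F θ h v hG hθ hB hE => ?_) htarget⟩
  refine ForSmallCouplings.mono (fun g₀ h' os hPr => ?_) (h19 F θ h v hG hθ hB hE)
  obtain ⟨δ, hδ', hsum⟩ := h' os hPr
  letI : DecidableEq (Σ K, SiteSeqKey F (0 + K)) := Classical.decEq _
  exact ⟨δ, core_badClass₁₃_cutZero_of_allClasses θ g₀ hδ', hsum⟩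

end Gap2RoadSF

end Summit.QuantumFields.YangMills.Theorems.N21GappedRoadK3V6Knit

end
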